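import Summits.CriticalPhenomena.PercolationContinuityZ3.Theorems.PercAnnulusCrossingHarrisSlackBounds
import Summits.CriticalPhenomena.PercolationContinuityZ3.Theorems.PercAnnulusCrossingNoiseSmallSets
import HarnessLib

/-!
# RSW3 lane (lead, gen 23): ANATOMY OF THE HARRIS SLACK, III — a quantitative Harris inequality: the covariance of two monotone
# functions is at least a fixed multiple of their level-1 joint pivotal weight, up to a hypercontractive error (abstract cube)

builds on p205010 (kernel theorem, internal audit signed; external expert review pending) — NOT used in this file (abstract).

Cell `prim-rsw3` (LANE 3), lead seat, gen 23.  Support file (`--supports stmt-CriticalPhenomena-4575`); no definitions, no named facts,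
no sorries.  Parts I–II gave `Cov(f,g) = ∫_0^1 Σ_i p_i(1−p_i)E[D_i f(ω)D_i g(ω^ε)] dε ≥ 0` and the monotonicity of `ε ↦ E[f(ω)g(ω^ε)]` for monotone
pairs.  Hence `Cov(f,g) ≥ E[f(ω)g(ω^{1−r})] − E[f]E[g] = Σ_{S≠∅} r^{|S|} f̂(S)ĝ(S)` for every `r ∈ [0,1]`; the level-1 part is
`r·Σ_i f̂(i)ĝ(i) = r·Σ_i p_i(1−p_i)·E[D_i f]·E[D_i g]` (for events: `r·Σ_i p_i(1−p_i)·P(i piv A)·P(i piv B)`), and the levels `≥ 2` are controlled by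
Cauchy–Schwarz and gen 22's `(4/3,2)`-hypercontractive bound `Σ_S ρ₀^{|S|} f̂(S)² ≤ (E|f|)^{3/2}` (admissible `ρ₀`: `ρ₀ ≤ 1/4`, `3ρ₀² ≤ p_i(1−p_i)`
at nondegenerate coordinates; on the lattice cube `ρ₀ = p(1−p)`).  Proved, every `p ∈ [0,1]^ι`:

* §1 `pow_mul_ge_level_one_sub` — for `0 ≤ r ≤ ρ₀` and `S ≠ ∅`: `r^{|S|}·F·G ≥ r·𝟙[|S|=1]·F·G − (r/ρ₀)²·ρ₀^{|S|}·|F|·|G|`;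
  `sum_erase_empty_pow_mul_ge` — summed, with Cauchy–Schwarz: `Σ_{S≠∅} r^{|S|}F(S)G(S) ≥ r·Σ_{|S|=1}FG − (r/ρ₀)²·√(Σ_S ρ₀^{|S|}F²)·√(Σ_S ρ₀^{|S|}G²)`.
* §2 **`cov_ge_level_one_sub_of_monotone`** — THE QUANTITATIVE HARRIS INEQUALITY (no characters in the statement): for coordinatewise
  non-decreasing `f, g` with values in `[−1,1]`, an admissible `ρ₀ > 0` and every `r ∈ [0, ρ₀]`,
  **`E[fg] − E[f]E[g] ≥ r·Σ_i p_i(1−p_i)·E[D_i f]·E[D_i g] − (r/ρ₀)²·√(t√t)·√(s√s)`**, `t = E|f|`, `s = E|g|` — a dimension-free lower bound on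
  the Harris slack by the level-1 joint pivotal weight `W₁(f,g) = Σ_i f̂(i)ĝ(i)`, polynomial in place of the logarithmic loss of Talagrand's
  `Cov ≥ c·W₁/log(e/W₁)` (uniform cube; Keller–Mossel–Sen for product measures), whose proof needs `(1+δ,2)`-hypercontractivity on biased bits.
  The parameter `r` is free: `r = ρ₀` gives `Cov ≥ ρ₀W₁ − √(t√t)√(s√s)`, and when `ρ₀W₁ ≤ 2√(t√t)√(s√s)` the choice
  `r = ρ₀²W₁/(2√(t√t)√(s√s))` gives `Cov ≥ ρ₀²W₁²/(4√(t√t)√(s√s))` (not spelled out as separate declarations).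

References: M. Talagrand, *How much are increasing sets positively correlated?*, Combinatorica 16 (1996) Thm 1.1; N. Keller, E. Mossel, A. Sen,
Ann. Inst. H. Poincaré 50 (2014) Thm 1.2–1.4; G. Kalai, N. Keller, E. Mossel, *On the correlation of increasing families*, JCTA 144 (2016);
R. O'Donnell, *Analysis of Boolean Functions*, CUP 2014, §9.5, §10.1 (hypercontractivity on the p-biased cube).
-/

noncomputable section

namespace Summit.CriticalPhenomena.PercolationContinuityZ3.Theorems.Crossing.Spectral

open Finset Function MeasureTheory intervalIntegral
open Literature.Probability.ODonnellSaksSchrammServedio2005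

variable {ι : Type*} [Fintype ι] [DecidableEq ι]

/-! ## §1 Levels `≥ 2` against the hypercontractive weight -/

omit [Fintype ι] [DecidableEq ι] in
/-- For `0 ≤ r ≤ ρ₀`, `0 < ρ₀` and a nonempty `S`: `r^{|S|}FG ≥ r·𝟙[|S| = 1]·FG − (r/ρ₀)²·ρ₀^{|S|}·|F||G|` (`r^k = (r/ρ₀)^k ρ₀^k ≤ (r/ρ₀)²ρ₀^k`
for `k ≥ 2`). [folklore] -/
theorem pow_mul_ge_level_one_sub {r ρ0 : ℝ} (hr0 : 0 ≤ r) (hr : r ≤ ρ0) (hρ0 : 0 < ρ0) {S : Finset ι} (hS : S ≠ ∅) (F G : ℝ) :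
    r * (if S.card = 1 then F * G else 0) - (r / ρ0) ^ 2 * (ρ0 ^ S.card * (|F| * |G|)) ≤ r ^ S.card * (F * G) := by
  have hk : 1 ≤ S.card := Finset.card_pos.2 (Finset.nonempty_iff_ne_empty.2 hS)
  have hFG : |F * G| = |F| * |G| := abs_mul F G
  have hq0 : 0 ≤ r / ρ0 := div_nonneg hr0 hρ0.le
  have hq1 : r / ρ0 ≤ 1 := (div_le_one hρ0).2 hr
  by_cases h1 : S.card = 1
  · rw [if_pos h1, h1, pow_one, pow_one]
    nlinarith [abs_nonneg F, abs_nonneg G, sq_nonneg (r / ρ0), mul_nonneg (mul_nonneg (sq_nonneg (r / ρ0)) hρ0.le)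
      (mul_nonneg (abs_nonneg F) (abs_nonneg G))]
  · rw [if_neg h1, mul_zero, zero_sub]
    have hk2 : 2 ≤ S.card := by omega
    -- `r^k = (r/ρ₀)^k ρ₀^k ≤ (r/ρ₀)² ρ₀^k`
    have hpow : r ^ S.card ≤ (r / ρ0) ^ 2 * ρ0 ^ S.card := by
      have : r ^ S.card = (r / ρ0) ^ S.card * ρ0 ^ S.card := by
        rw [← mul_pow, div_mul_cancel₀ r hρ0.ne']
      rw [this]
      exact mul_le_mul_of_nonneg_right (pow_le_pow_of_le_one hq0 hq1 hk2) (pow_nonneg hρ0.le _)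
    have habs : |r ^ S.card * (F * G)| ≤ (r / ρ0) ^ 2 * (ρ0 ^ S.card * (|F| * |G|)) := by
      rw [abs_mul, abs_of_nonneg (pow_nonneg hr0 _), hFG]
      have := mul_le_mul_of_nonneg_right hpow (mul_nonneg (abs_nonneg F) (abs_nonneg G))
      linarith [this, (by ring : (r / ρ0) ^ 2 * ρ0 ^ S.card * (|F| * |G|) = (r / ρ0) ^ 2 * (ρ0 ^ S.card * (|F| * |G|)))]
    linarith [neg_abs_le (r ^ S.card * (F * G))]

/-- **LEVELS `≥ 2` AGAINST THE HYPERCONTRACTIVE WEIGHT**: for `0 ≤ r ≤ ρ₀`, `0 < ρ₀` and coefficient sequences `F, G`,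
`Σ_{S≠∅} r^{|S|}F(S)G(S) ≥ r·Σ_i F({i})G({i}) − (r/ρ₀)²·√(Σ_S ρ₀^{|S|}F(S)²)·√(Σ_S ρ₀^{|S|}G(S)²)` (termwise bound and Cauchy–Schwarz with the
weights `ρ₀^{|S|}`). [cite: Talagrand1996, §2 (the levels ≥ 2 are the error term)] -/
theorem sum_erase_empty_pow_mul_ge {r ρ0 : ℝ} (hr0 : 0 ≤ r) (hr : r ≤ ρ0) (hρ0 : 0 < ρ0) (F G : Finset ι → ℝ) :
    r * ∑ i, F {i} * G {i}
        - (r / ρ0) ^ 2 * (Real.sqrt (∑ S ∈ (Finset.univ : Finset ι).powerset, ρ0 ^ S.card * F S ^ 2)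
          * Real.sqrt (∑ S ∈ (Finset.univ : Finset ι).powerset, ρ0 ^ S.card * G S ^ 2))
      ≤ ∑ S ∈ (Finset.univ : Finset ι).powerset.erase ∅, r ^ S.card * (F S * G S) := by
  classical
  -- the level-1 sum as a sum over singletons
  have hlev1 : ∑ S ∈ (Finset.univ : Finset ι).powerset.erase ∅, (if S.card = 1 then F S * G S else 0) = ∑ i, F {i} * G {i} := by
    rw [← Finset.sum_filter]
    have hset : ((Finset.univ : Finset ι).powerset.erase ∅).filter (fun S => S.card = 1) = Finset.powersetCard 1 (Finset.univ : Finset ι) := by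
      ext S
      simp only [Finset.mem_filter, Finset.mem_erase, Finset.mem_powerset, Finset.subset_univ, and_true, Finset.mem_powersetCard,
        true_and]
      constructor
      · exact fun h => h.2
      · intro h
        refine ⟨?_, h⟩
        intro hS; rw [hS, Finset.card_empty] at h; exact absurd h (by norm_num)
    rw [hset, Finset.powersetCard_one, Finset.sum_map]
    rfl
  -- termwise
  have hterm : ∑ S ∈ (Finset.univ : Finset ι).powerset.erase ∅,
      (r * (if S.card = 1 then F S * G S else 0) - (r / ρ0) ^ 2 * (ρ0 ^ S.card * (|F S| * |G S|)))
      ≤ ∑ S ∈ (Finset.univ : Finset ι).powerset.erase ∅, r ^ S.card * (F S * G S) :=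
    Finset.sum_le_sum fun S hS => pow_mul_ge_level_one_sub hr0 hr hρ0 (Finset.mem_erase.1 hS).1 (F S) (G S)
  rw [Finset.sum_sub_distrib, ← Finset.mul_sum, ← Finset.mul_sum, hlev1] at hterm
  -- Cauchy–Schwarz with weights `ρ₀^{|S|}`
  have hcs : ∑ S ∈ (Finset.univ : Finset ι).powerset.erase ∅, ρ0 ^ S.card * (|F S| * |G S|)
      ≤ Real.sqrt (∑ S ∈ (Finset.univ : Finset ι).powerset, ρ0 ^ S.card * F S ^ 2)
          * Real.sqrt (∑ S ∈ (Finset.univ : Finset ι).powerset, ρ0 ^ S.card * G S ^ 2) := by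
    have hsub : ∑ S ∈ (Finset.univ : Finset ι).powerset.erase ∅, ρ0 ^ S.card * (|F S| * |G S|)
        ≤ ∑ S ∈ (Finset.univ : Finset ι).powerset, ρ0 ^ S.card * (|F S| * |G S|) :=
      Finset.sum_le_sum_of_subset_of_nonneg (Finset.erase_subset _ _)
        (fun S _ _ => mul_nonneg (pow_nonneg hρ0.le _) (mul_nonneg (abs_nonneg _) (abs_nonneg _)))
    refine hsub.trans ?_
    have h := Real.sum_mul_le_sqrt_mul_sqrt (Finset.univ : Finset ι).powerset
      (fun S => Real.sqrt (ρ0 ^ S.card) * |F S|) (fun S => Real.sqrt (ρ0 ^ S.card) * |G S|)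
    have hsq : ∀ (S : Finset ι) (H : ℝ), (Real.sqrt (ρ0 ^ S.card) * |H|) ^ 2 = ρ0 ^ S.card * H ^ 2 := by
      intro S H; rw [mul_pow, Real.sq_sqrt (pow_nonneg hρ0.le _), sq_abs]
    have hprod : ∀ S : Finset ι, Real.sqrt (ρ0 ^ S.card) * |F S| * (Real.sqrt (ρ0 ^ S.card) * |G S|)
        = ρ0 ^ S.card * (|F S| * |G S|) := by
      intro S
      have := Real.mul_self_sqrt (pow_nonneg hρ0.le S.card)
      calc Real.sqrt (ρ0 ^ S.card) * |F S| * (Real.sqrt (ρ0 ^ S.card) * |G S|)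
          = (Real.sqrt (ρ0 ^ S.card) * Real.sqrt (ρ0 ^ S.card)) * (|F S| * |G S|) := by ring
        _ = ρ0 ^ S.card * (|F S| * |G S|) := by rw [this]
    simp only [hsq, hprod] at h
    exact h
  nlinarith [hcs, sq_nonneg (r / ρ0), mul_le_mul_of_nonneg_left hcs (sq_nonneg (r / ρ0))]

/-! ## §2 The quantitative Harris inequality -/

section Lower

variable {p : ι → ℝ} (h0 : ∀ i, 0 ≤ p i) (h1 : ∀ i, p i ≤ 1) {r' : ι → Bool → ℝ}
  (hH1 : ∀ i, p i * r' i true + (1 - p i) * r' i false = 0)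
  (hH2 : ∀ i (b b' : Bool), coordWt p i b ≠ 0 → coordWt p i b' * (1 + r' i b * r' i b') = if b' = b then 1 else 0)

omit [DecidableEq ι] in
/-- `W² ≤ t³` with `W, t ≥ 0` gives `√W ≤ √(t√t)` (`(t√t)² = t³`). [folklore] -/
theorem sqrt_le_sqrt_mul_sqrt_of_sq_le_cube {W t : ℝ} (hW : 0 ≤ W) (ht : 0 ≤ t) (h : W ^ 2 ≤ t ^ 3) :
    Real.sqrt W ≤ Real.sqrt (t * Real.sqrt t) := by
  refine Real.sqrt_le_sqrt ?_
  have hts : 0 ≤ t * Real.sqrt t := mul_nonneg ht (Real.sqrt_nonneg t)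
  have hsq : (t * Real.sqrt t) ^ 2 = t ^ 3 := by
    rw [mul_pow, Real.sq_sqrt ht]; ring
  exact (pow_le_pow_iff_left₀ hW hts two_ne_zero).1 (by rw [hsq]; exact h)

include h0 h1 hH1 hH2 in
/-- **THE QUANTITATIVE HARRIS INEQUALITY, with characters**: for coordinatewise non-decreasing `f, g` with `|f|, |g| ≤ 1`, an admissible
`ρ₀` (`0 < ρ₀ ≤ 1/4`, `3ρ₀² ≤ p_i(1−p_i)` at nondegenerate coordinates) and `0 ≤ r ≤ ρ₀`:
`E[fg] − E[f]E[g] ≥ r·Σ_i f̂(i)ĝ(i) − (r/ρ₀)²·√(t√t)·√(s√s)` with `t = E|f|`, `s = E|g|`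
(monotonicity in the noise down to `ε = 1−r`, §1, and gen 22's `Σ_S ρ₀^{|S|}f̂(S)² ≤ t^{3/2}`).
[cite: Talagrand1996, Thm 1.1 (Cov ≥ c φ(Σ_i I_i(A)I_i(B)))] [cite: KellerMosselSen2014, Thm 1.2] [cite: ODonnell2014, §9.5, §10.1] -/
theorem cov_ge_level_one_sub (f g : (ι → Bool) → ℝ)
    (hf : ∀ i x, f (update x i false) ≤ f (update x i true)) (hg : ∀ i x, g (update x i false) ≤ g (update x i true))
    (hf1 : ∀ x, |f x| ≤ 1) (hg1 : ∀ x, |g x| ≤ 1)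
    {ρ0 : ℝ} (hρ0 : 0 < ρ0) (hρ2 : ρ0 ≤ 1 / 4) (hρ4 : ∀ i, 0 < p i → p i < 1 → 3 * ρ0 ^ 2 ≤ p i * (1 - p i))
    {r : ℝ} (hr0 : 0 ≤ r) (hr : r ≤ ρ0) :
    r * ∑ i, (∑ x : ι → Bool, wt p x * (f x * ∏ j ∈ ({i} : Finset ι), r' j (x j)))
          * (∑ x : ι → Bool, wt p x * (g x * ∏ j ∈ ({i} : Finset ι), r' j (x j)))
        - (r / ρ0) ^ 2 * (Real.sqrt ((∑ x : ι → Bool, wt p x * |f x|) * Real.sqrt (∑ x : ι → Bool, wt p x * |f x|))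
          * Real.sqrt ((∑ x : ι → Bool, wt p x * |g x|) * Real.sqrt (∑ x : ι → Bool, wt p x * |g x|)))
      ≤ ∑ x : ι → Bool, wt p x * (f x * g x) - (∑ x : ι → Bool, wt p x * f x) * (∑ x : ι → Bool, wt p x * g x) := by
  classical
  obtain ⟨F, hF⟩ : ∃ F : Finset ι → ℝ, F = fun S => ∑ x : ι → Bool, wt p x * (f x * ∏ j ∈ S, r' j (x j)) := ⟨_, rfl⟩
  obtain ⟨G, hG⟩ : ∃ G : Finset ι → ℝ, G = fun S => ∑ x : ι → Bool, wt p x * (g x * ∏ j ∈ S, r' j (x j)) := ⟨_, rfl⟩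
  -- Step 1: monotonicity in the noise, down to `ε = 1 − r`
  have hr1 : 1 - r ≤ 1 := by linarith
  have h1r : 0 ≤ 1 - r := by linarith
  have hmono := noise_cross_correlation_antitone p h0 h1 f g hf hg le_rfl h1r hr1
  rw [noise_zero_eq p f g, noise_cross_correlation_eq_sum_coeff hH1 hH2 f g (1 - r)] at hmono
  simp only [sub_sub_cancel] at hmono
  -- Step 2: `E f E g = F(∅) G(∅)` and the sum over `S ≠ ∅`
  have hmean : (∑ x : ι → Bool, wt p x * f x) * (∑ x : ι → Bool, wt p x * g x) = r ^ (∅ : Finset ι).card * (F ∅ * G ∅) := by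
    rw [hF, hG, Finset.card_empty, pow_zero, one_mul]; simp
  have hsplit : ∑ S ∈ (Finset.univ : Finset ι).powerset, r ^ S.card * (F S * G S)
      = r ^ (∅ : Finset ι).card * (F ∅ * G ∅) + ∑ S ∈ (Finset.univ : Finset ι).powerset.erase ∅, r ^ S.card * (F S * G S) :=
    (Finset.add_sum_erase _ _ (Finset.empty_mem_powerset _)).symm
  -- Step 3: §1
  have hlow := sum_erase_empty_pow_mul_ge hr0 hr hρ0 F G
  -- Step 4: the hypercontractive weights (gen 22), `(1−ε)² = ρ₀` with `ε = 1 − √ρ₀`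
  set ε : ℝ := 1 - Real.sqrt ρ0 with hεdef
  have hε : (1 - ε) ^ 2 = ρ0 := by rw [hεdef, sub_sub_cancel, Real.sq_sqrt hρ0.le]
  have hρ2' : (1 - ε) ^ 2 ≤ 1 / 4 := by rw [hε]; exact hρ2
  have hρ4' : ∀ i, 0 < p i → p i < 1 → 3 * (1 - ε) ^ 4 ≤ p i * (1 - p i) := by
    intro i hp0 hp1
    have : (1 - ε) ^ 4 = ρ0 ^ 2 := by rw [← hε]; ring
    rw [this]; exact hρ4 i hp0 hp1
  have hWf := sq_noise_weight_le_cube h0 h1 hH1 hH2 hρ2' hρ4' f hf1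
  have hWg := sq_noise_weight_le_cube h0 h1 hH1 hH2 hρ2' hρ4' g hg1
  rw [hε] at hWf hWg
  have ht0 : 0 ≤ ∑ x : ι → Bool, wt p x * |f x| := Finset.sum_nonneg fun x _ => mul_nonneg (wt_nonneg h0 h1 x) (abs_nonneg _)
  have hs0 : 0 ≤ ∑ x : ι → Bool, wt p x * |g x| := Finset.sum_nonneg fun x _ => mul_nonneg (wt_nonneg h0 h1 x) (abs_nonneg _)
  have hWf0 : 0 ≤ ∑ S ∈ (Finset.univ : Finset ι).powerset, ρ0 ^ S.card * F S ^ 2 :=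
    Finset.sum_nonneg fun S _ => mul_nonneg (pow_nonneg hρ0.le _) (sq_nonneg _)
  have hWg0 : 0 ≤ ∑ S ∈ (Finset.univ : Finset ι).powerset, ρ0 ^ S.card * G S ^ 2 :=
    Finset.sum_nonneg fun S _ => mul_nonneg (pow_nonneg hρ0.le _) (sq_nonneg _)
  have hsqf : Real.sqrt (∑ S ∈ (Finset.univ : Finset ι).powerset, ρ0 ^ S.card * F S ^ 2)
      ≤ Real.sqrt ((∑ x : ι → Bool, wt p x * |f x|) * Real.sqrt (∑ x : ι → Bool, wt p x * |f x|)) := by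
    refine sqrt_le_sqrt_mul_sqrt_of_sq_le_cube hWf0 ht0 ?_
    rw [hF]; exact hWf
  have hsqg : Real.sqrt (∑ S ∈ (Finset.univ : Finset ι).powerset, ρ0 ^ S.card * G S ^ 2)
      ≤ Real.sqrt ((∑ x : ι → Bool, wt p x * |g x|) * Real.sqrt (∑ x : ι → Bool, wt p x * |g x|)) := by
    refine sqrt_le_sqrt_mul_sqrt_of_sq_le_cube hWg0 hs0 ?_
    rw [hG]; exact hWg
  have herr := mul_le_mul hsqf hsqg (Real.sqrt_nonneg _) (Real.sqrt_nonneg _)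
  -- assemble
  have hX : ∑ i, (∑ x : ι → Bool, wt p x * (f x * ∏ j ∈ ({i} : Finset ι), r' j (x j)))
        * (∑ x : ι → Bool, wt p x * (g x * ∏ j ∈ ({i} : Finset ι), r' j (x j))) = ∑ i, F {i} * G {i} := by
    rw [hF, hG]
  rw [hX]
  have hmono' : ∑ S ∈ (Finset.univ : Finset ι).powerset, r ^ S.card * (F S * G S) ≤ ∑ x : ι → Bool, wt p x * (f x * g x) := by
    rw [hF, hG]; exact hmono
  rw [hsplit, ← hmean] at hmono'
  nlinarith [hmono', hlow, herr, sq_nonneg (r / ρ0), mul_le_mul_of_nonneg_left herr (sq_nonneg (r / ρ0))]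

include hH1 in
/-- The level-1 product coefficient in the pivotal currency: `f̂({i})·ĝ({i}) = p_i(1−p_i)·E[D_i f]·E[D_i g]` (part I's `coeff_insert_eq_bias_mul`
with `S = ∅` and `(p_i r_i(1))² = p_i(1−p_i)`). [cite: ODonnell2014, §8.4 Prop 8.45 (f̂(i) = σ·E[D_i f] for the p-biased derivative)] -/
theorem coeff_singleton_mul_eq (hH2' : ∀ i (b b' : Bool), coordWt p i b ≠ 0 → coordWt p i b' * (1 + r' i b * r' i b') = if b' = b then 1 else 0)
    (f g : (ι → Bool) → ℝ) (i : ι) :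
    (∑ x : ι → Bool, wt p x * (f x * ∏ j ∈ ({i} : Finset ι), r' j (x j)))
        * (∑ x : ι → Bool, wt p x * (g x * ∏ j ∈ ({i} : Finset ι), r' j (x j)))
      = p i * (1 - p i) * ((∑ x : ι → Bool, wt p x * (f (update x i true) - f (update x i false)))
          * (∑ x : ι → Bool, wt p x * (g (update x i true) - g (update x i false)))) := by
  have hfi := coeff_insert_eq_bias_mul hH1 f (S := ∅) (i := i) (Finset.notMem_empty i)
  have hgi := coeff_insert_eq_bias_mul hH1 g (S := ∅) (i := i) (Finset.notMem_empty i)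
  simp only [Finset.insert_empty, Finset.prod_empty, mul_one] at hfi hgi
  rw [hfi, hgi, ← sq_bias_mul_char_eq hH2' i]
  ring

end Lower

/-- **THE QUANTITATIVE HARRIS INEQUALITY** (no characters; every `p ∈ [0,1]^ι`): for coordinatewise non-decreasing `f, g` with `|f|, |g| ≤ 1`,
`0 < ρ₀ ≤ 1/4` with `3ρ₀² ≤ p_i(1−p_i)` at every nondegenerate coordinate, and every `0 ≤ r ≤ ρ₀`,
**`E[fg] − E[f]E[g] ≥ r·Σ_i p_i(1−p_i)·E[D_i f]·E[D_i g] − (r/ρ₀)²·√(t√t)·√(s√s)`** (`t = E|f|`, `s = E|g|`).  For increasing events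
`A, B` (`f = 𝟙_A`, `g = 𝟙_B`): `P(A∩B) − P(A)P(B) ≥ r·Σ_i p_i(1−p_i)·P(i piv A)·P(i piv B) − (r/ρ₀)²·(P(A)P(B))^{3/4}` — the Harris slack is at least
a fixed fraction of the level-1 joint pivotal weight, up to a hypercontractive error; dimension-free.
[cite: Talagrand1996, Thm 1.1] [cite: KellerMosselSen2014, Thm 1.2] [cite: ODonnell2014, §9.5 / §10.1] -/
theorem cov_ge_level_one_sub_of_monotone (p : ι → ℝ) (h0 : ∀ i, 0 ≤ p i) (h1 : ∀ i, p i ≤ 1) (f g : (ι → Bool) → ℝ)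
    (hf : ∀ i x, f (update x i false) ≤ f (update x i true)) (hg : ∀ i x, g (update x i false) ≤ g (update x i true))
    (hf1 : ∀ x, |f x| ≤ 1) (hg1 : ∀ x, |g x| ≤ 1)
    {ρ0 : ℝ} (hρ0 : 0 < ρ0) (hρ2 : ρ0 ≤ 1 / 4) (hρ4 : ∀ i, 0 < p i → p i < 1 → 3 * ρ0 ^ 2 ≤ p i * (1 - p i))
    {r : ℝ} (hr0 : 0 ≤ r) (hr : r ≤ ρ0) :
    r * ∑ i, p i * (1 - p i) * ((∑ x : ι → Bool, wt p x * (f (update x i true) - f (update x i false)))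
          * (∑ x : ι → Bool, wt p x * (g (update x i true) - g (update x i false))))
        - (r / ρ0) ^ 2 * (Real.sqrt ((∑ x : ι → Bool, wt p x * |f x|) * Real.sqrt (∑ x : ι → Bool, wt p x * |f x|))
          * Real.sqrt ((∑ x : ι → Bool, wt p x * |g x|) * Real.sqrt (∑ x : ι → Bool, wt p x * |g x|)))
      ≤ ∑ x : ι → Bool, wt p x * (f x * g x) - (∑ x : ι → Bool, wt p x * f x) * (∑ x : ι → Bool, wt p x * g x) := by
  have hH1 := pbiased_H1 p
  have hH2 := pbiased_H2 p h0 h1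
  have h := cov_ge_level_one_sub h0 h1 hH1 hH2 f g hf hg hf1 hg1 hρ0 hρ2 hρ4 hr0 hr
  simp only [coeff_singleton_mul_eq hH1 hH2 f g] at h
  exact h

end Summit.CriticalPhenomena.PercolationContinuityZ3.Theorems.Crossing.Spectral

end
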